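import Literature.AlgebraicGeometry.Frobenioids.BaseSectionsOfObjectsCor57Proofs
import Literature.AlgebraicGeometry.Frobenioids.CategoryTheoreticityFacts
import Literature.AlgebraicGeometry.Frobenioids.DivisorMonoidCategoryTheoreticityFacts
import HarnessLib

/-!
# Frobenioids I, Corollary 5.7 (iii), (iv) — PROOFS modulo the typed Theorem 3.4 (ii)/(iii) and
# Corollary 4.11 (ii)

Mochizuki, *The geometry of Frobenioids I: the general theory*, Kyushu J. Math. **62** (2008)
293–400, kurims text Cor. 5.7 (iii), (iv) p. 108 [cite: MochizukiFrdI2008, Cor. 5.7 (iii) p.108].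

PROOF-ONLY companion of `BaseSectionsOfObjects.lean` (seat abc-iut-L1-t5), continuing
`BaseSectionsOfObjectsCor57Proofs.lean`:

* `exists_sigma_transport`: the section `σ₁ : Aut_{D₁}(Base A₁) → Aut_{C₁}(A₁)` of a base-Frobenius pair
  of `A₁` is carried to `σ₂ := Ψ ∘ σ₁ ∘ θ`, `θ : Aut_{D₂}(Base Ψ A₁) ⥲ Aut_{D₁}(Base A₁)` (conjugation by
  `η_{A₁}`, then `(Ψ^Base)⁻¹` on automorphisms);
* `cor57iii_core_of` / `cor57iii_of`: (iii) quasi-base-Frobenius pairs of a Frobenius-trivial object go to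
  quasi-base-Frobenius pairs of its (Frobenius-trivial) image, modulo Thm. 3.4 (iii) + Cor. 4.11 (ii) —
  the printed model-type / unit-profinite hypotheses are carried by the typed statement but not used;
* `psiN_eq_refl`: under the hypothesis of (iv) ("when `C₁`, `C₂` are of group-like type, `Ψ` … preserves
  Frobenius degrees") and Thm. 3.4 (ii) for `Ψ`, `Ψ⁻¹` (preservation of group-like objects), the
  automorphism `Ψ^{N_{≥1}}` is the identity on a Frobenioid with a Frobenius-trivial object;
* `cor57iv_of`: (iv) — "quasi-" removed in (i) and (iii), modulo Thm. 3.4 (ii) (both directions),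
  Thm. 3.4 (iii) and Cor. 4.11 (ii);
* `cor57ii_of_facts`, `cor57i_sections_of_facts`, `cor57i_pairs_of_facts`,
  `isOfPreModelType_iff_of_facts`, `cor57iii_of_facts`, `cor57iv_of_facts`: all of Cor. 5.7 restated
  conditional ONLY on the cell's closed named facts `FrdI.Thm34ii`, `FrdI.Thm34iii`
  (`CategoryTheoreticityFacts`) and `FrdI.Cor411ii` (`DivisorMonoidCategoryTheoreticityFacts`) —
  unconditional as soon as those facts are discharged.

The typed (iii), (iv) are SCHEMAS in birationalization data `B₁`, `B₂` (only entering the unused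
model-type hypotheses); they are proved for all `B_i`. Nothing here is specific to the abc programme; no
statement of the paper is strengthened.
-/

namespace Literature.AlgebraicGeometry.Frobenioids

open CategoryTheory Opposite

universe w v v' u u'

namespace PreFrobenioid

section PairsOfObjects

variable {D₁ : Type u} [Category.{v} D₁] {Φ₁ : D₁ᵒᵖ ⥤ CommMonCat.{w}}
  {C₁ : Type u'} [Category.{v'} C₁] (F₁ : C₁ ⥤ ElemFrobenioid Φ₁)
  {D₂ : Type u} [Category.{v} D₂] {Φ₂ : D₂ᵒᵖ ⥤ CommMonCat.{w}}
  {C₂ : Type u'} [Category.{v'} C₂] (F₂ : C₂ ⥤ ElemFrobenioid Φ₂)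
  (Ψ : C₁ ≌ C₂)

/-- Transport of a base-section-valued section `σ₁ : Aut_{D₁}(Base A₁) → Aut_{C₁}(A₁)` (values in `P`,
`Base ∘ σ₁ = id`) along `Ψ` lying over a full and faithful `Ψ^Base`: `σ₂ := Ψ ∘ σ₁ ∘ θ`, where
`θ : Aut_{D₂}(Base Ψ A₁) ⥲ Aut_{D₁}(Base A₁)` is conjugation by `η_{A₁}` followed by the inverse of
`Ψ^Base` on automorphisms; `Base ∘ σ₂ = id`, the values of `σ₂` lie in `Ψ(P)`, and the images of `σ₁`,
`σ₂` correspond under `Ψ`. [cite: MochizukiFrdI2008, Cor. 5.7 (iii) p.108] -/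
theorem exists_sigma_transport (ΨBase : D₁ ⥤ D₂) [ΨBase.Full] [ΨBase.Faithful]
    (η : Ψ.functor ⋙ baseFunctor F₂ ≅ baseFunctor F₁ ⋙ ΨBase) {P : Presection C₁} {P₂ : Presection C₂}
    (hmaps : MapsInto Ψ P P₂) {A₁ : C₁} (σ₁ : Aut (baseObj F₁ A₁) →* Aut A₁)
    (hbase : ∀ α : Aut (baseObj F₁ A₁), (baseFunctor F₁).mapIso (σ₁ α) = α)
    (hmem : ∀ α : Aut (baseObj F₁ A₁), P.hom (σ₁ α).hom) :
    ∃ σ₂ : Aut (baseObj F₂ (Ψ.functor.obj A₁)) →* Aut (Ψ.functor.obj A₁),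
      (∀ β, (baseFunctor F₂).mapIso (σ₂ β) = β) ∧ (∀ β, P₂.hom (σ₂ β).hom) ∧
        (∀ α, ∃ β, σ₂ β = Ψ.functor.mapIso (σ₁ α)) ∧ ∀ β, ∃ α, σ₂ β = Ψ.functor.mapIso (σ₁ α) := by
  -- `θ : Aut(Base₂ Ψ A₁) ⥲ Aut(Base₁ A₁)`
  let hff : ΨBase.FullyFaithful := Functor.FullyFaithful.ofFullyFaithful ΨBase
  let e₁ : Aut ((Ψ.functor ⋙ baseFunctor F₂).obj A₁) ≃* Aut ((baseFunctor F₁ ⋙ ΨBase).obj A₁) :=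
    Aut.autMulEquivOfIso (η.app A₁)
  let e₂ : Aut ((baseFunctor F₁).obj A₁) ≃* Aut (ΨBase.obj ((baseFunctor F₁).obj A₁)) :=
    hff.autMulEquivOfFullyFaithful ((baseFunctor F₁).obj A₁)
  let θ : Aut ((Ψ.functor ⋙ baseFunctor F₂).obj A₁) ≃* Aut ((baseFunctor F₁).obj A₁) := e₁.trans e₂.symm
  have hθ : ∀ β : Aut ((Ψ.functor ⋙ baseFunctor F₂).obj A₁),
      ΨBase.map (θ β).hom = η.inv.app A₁ ≫ β.hom ≫ η.hom.app A₁ := by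
    intro β
    have h1 : ΨBase.mapIso (θ β) = e₁ β := by
      show e₂ (e₂.symm (e₁ β)) = e₁ β
      exact e₂.apply_symm_apply _
    exact congrArg Iso.hom h1
  let σ₂ : Aut ((Ψ.functor ⋙ baseFunctor F₂).obj A₁) →* Aut (Ψ.functor.obj A₁) :=
    (Functor.mapAut A₁ Ψ.functor).comp (σ₁.comp θ.toMonoidHom)
  have hσ₂ : ∀ β, σ₂ β = Ψ.functor.mapIso (σ₁ (θ β)) := fun β => rfl
  refine ⟨σ₂, fun β => ?_, fun β => hmaps.2 _ (hmem (θ β)), fun α => ⟨θ.symm α, ?_⟩, fun β => ⟨θ β, hσ₂ β⟩⟩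
  · obtain ⟨β, rfl⟩ : ∃ β' : Aut ((Ψ.functor ⋙ baseFunctor F₂).obj A₁), β' = β := ⟨β, rfl⟩
    apply Iso.ext
    have hb : (baseFunctor F₁).map (σ₁ (θ β)).hom = (θ β).hom := congrArg Iso.hom (hbase (θ β))
    show (Ψ.functor ⋙ baseFunctor F₂).map (σ₁ (θ β)).hom = β.hom
    rw [comp_base_map_eq_conj F₁ F₂ Ψ ΨBase η]
    have h2 : (baseFunctor F₁ ⋙ ΨBase).map (σ₁ (θ β)).hom = η.inv.app A₁ ≫ β.hom ≫ η.hom.app A₁ := by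
      show ΨBase.map ((baseFunctor F₁).map (σ₁ (θ β)).hom) = _
      rw [hb]
      exact hθ β
    rw [h2]
    simp
  · show Ψ.functor.mapIso (σ₁ (θ (θ.symm α))) = Ψ.functor.mapIso (σ₁ α)
    rw [θ.apply_symm_apply]

/-- **Corollary 5.7 (iii)**, core statement, DISCHARGED modulo [FrdI] Thm. 3.4 (iii) and Cor. 4.11 (ii) (as
typed): `Ψ` maps a quasi-base-Frobenius pair `(σ₁, φ₁)` of a Frobenius-trivial `A₁ ∈ Ob(C₁)` to a
quasi-base-Frobenius pair `(σ₂, φ₂)` of the Frobenius-trivial object `Ψ(A₁)`: `σ₂ := Ψ ∘ σ₁ ∘ θ`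
(`exists_sigma_transport`) and `φ₂(m) := F₂(m)_{Ψ A₁}` for the base-Frobenius pair `(Ψ P, F₂)` of
Cor. 5.7 (i). The model-type and unit-profinite hypotheses of the printed (iii) are not needed for this
construction. [cite: MochizukiFrdI2008, Cor. 5.7 (iii) p.108] -/
theorem cor57iii_core_of
    (h34 : (PreFrobenioidData.ofFunctor Φ₁ F₁).Thm34iii (PreFrobenioidData.ofFunctor Φ₂ F₂) Ψ)
    (h411 : (PreFrobenioidData.ofFunctor Φ₁ F₁).Cor411ii (PreFrobenioidData.ofFunctor Φ₂ F₂) Ψ)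
    (hyp : Cor57Hypotheses F₁ F₂ Ψ) (A₁ : C₁) (σ₁ : Aut (baseObj F₁ A₁) →* Aut A₁) (φ₁ : ℕ+ →* End A₁)
    (hA₁ : IsFrobeniusTrivial F₁ A₁) (hq : IsQuasiBaseFrobeniusPairOfObj F₁ A₁ σ₁ φ₁) :
    IsFrobeniusTrivial F₂ (Ψ.functor.obj A₁) ∧
      ∃ (σ₂ : Aut (baseObj F₂ (Ψ.functor.obj A₁)) →* Aut (Ψ.functor.obj A₁))
        (φ₂ : ℕ+ →* End (Ψ.functor.obj A₁)) (τ : ℕ+ ≃* ℕ+),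
        IsQuasiBaseFrobeniusPairOfObj F₂ (Ψ.functor.obj A₁) σ₂ φ₂ ∧ MapsPair F₁ F₂ Ψ σ₁ φ₁ σ₂ φ₂ τ := by
  obtain ⟨τ₀, P, Fr, hPF, hR⟩ := hq
  have hB : (PreFrobenioidData.ofFunctor Φ₁ F₁).HypB (PreFrobenioidData.ofFunctor Φ₂ F₂) Ψ := fun g₁ g₂ =>
    ⟨fun _ _ φ hφ => hyp.baseIso_functor (fun A => g₁.obj A) (fun A => g₂.obj A) φ hφ,
      fun _ _ φ hφ => hyp.baseIso_inverse (fun A => g₁.obj A) (fun A => g₂.obj A) φ hφ⟩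
  obtain ⟨⟨hft, -, -, -, hpb, -, -⟩, ΨN, hN, -⟩ := h34 hyp.standard₁ hyp.standard₂ hB
  obtain ⟨ΨBase, ⟨hEq, ⟨η⟩, -⟩, -⟩ :=
    h411 { divSlim := ⟨hyp.divSlim₁, hyp.divSlim₂⟩, standard := ⟨hyp.standard₁, hyp.standard₂⟩, hypB := hB }
  haveI := hEq
  refine ⟨isFrobeniusTrivial_map_of_square F₁ F₂ Ψ ΨBase η hft ΨN hN hA₁, ?_⟩
  -- the image base-Frobenius pair `(Ψ P, F₂)` of Cor. 5.7 (i)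
  obtain ⟨P₂, Fr₂, hmaps, hPF₂, hcomp⟩ := cor57i_pairs_core F₁ F₂ Ψ ΨBase η hpb hft ΨN hN hPF
  have mem₂ : P₂.obj (Ψ.functor.obj A₁) := hmaps.1 A₁ hR.mem
  obtain ⟨σ₂, hb₂, hm₂, hα, hβ⟩ :=
    exists_sigma_transport F₁ F₂ Ψ ΨBase η hmaps σ₁ hR.base_σ hR.σ_mem
  -- `φ₂ := F₂(-)_{Ψ A₁}`
  let φ₂ : ℕ+ →* End (Ψ.functor.obj A₁) :=
    { toFun := fun n => (Fr₂ n).app ⟨Ψ.functor.obj A₁, mem₂⟩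
      map_one' := by
        show (Fr₂ 1).app ⟨Ψ.functor.obj A₁, mem₂⟩ = 𝟙 (Ψ.functor.obj A₁)
        exact (congrArg (fun t : End P₂.ι => t.app ⟨Ψ.functor.obj A₁, mem₂⟩) (map_one Fr₂)).trans rfl
      map_mul' := fun m n => by
        show (Fr₂ (m * n)).app ⟨Ψ.functor.obj A₁, mem₂⟩ =
          (Fr₂ n).app ⟨Ψ.functor.obj A₁, mem₂⟩ ≫ (Fr₂ m).app ⟨Ψ.functor.obj A₁, mem₂⟩
        exact (congrArg (fun t : End P₂.ι => t.app ⟨Ψ.functor.obj A₁, mem₂⟩) (map_mul Fr₂ m n)).trans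
          rfl }
  refine ⟨σ₂, φ₂, τ₀.symm.trans ΨN, ⟨MulEquiv.refl ℕ+, P₂, Fr₂, hPF₂, ⟨mem₂, hb₂, hm₂, fun n => rfl⟩⟩,
    hα, hβ, fun n => ?_⟩
  -- `Ψ(φ₁ n) = Ψ(F₁(τ₀⁻¹ n)_{A₁}) = F₂(ΨN (τ₀⁻¹ n))_{Ψ A₁} = φ₂ ((τ₀⁻¹ ≫ ΨN) n)`
  have h1 : φ₁ n = (Fr (τ₀.symm n)).app ⟨A₁, hR.mem⟩ := by
    have := hR.φ_eq (τ₀.symm n)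
    rwa [MonoidHom.comp_apply, MulEquiv.coe_toMonoidHom, MulEquiv.apply_symm_apply] at this
  rw [h1]
  exact hcomp (τ₀.symm n) A₁ hR.mem

/-- **Corollary 5.7 (iii)** as typed (SCHEMA in the birationalization data `B₁`, `B₂`; the model-type and
unit-profinite hypotheses are carried but not used), DISCHARGED modulo [FrdI] Thm. 3.4 (iii) and
Cor. 4.11 (ii). [cite: MochizukiFrdI2008, Cor. 5.7 (iii) p.108] -/
theorem cor57iii_of (B₁ : (PreFrobenioidData.ofFunctor Φ₁ F₁).BiratData)
    (B₂ : (PreFrobenioidData.ofFunctor Φ₂ F₂).BiratData)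
    (h34 : (PreFrobenioidData.ofFunctor Φ₁ F₁).Thm34iii (PreFrobenioidData.ofFunctor Φ₂ F₂) Ψ)
    (h411 : (PreFrobenioidData.ofFunctor Φ₁ F₁).Cor411ii (PreFrobenioidData.ofFunctor Φ₂ F₂) Ψ) :
    Cor57iii F₁ F₂ Ψ B₁ B₂ :=
  fun hyp _ _ _ _ _ _ A₁ σ₁ φ₁ hA₁ hq => cor57iii_core_of F₁ F₂ Ψ h34 h411 hyp A₁ σ₁ φ₁ hA₁ hq

/-! ### Corollary 5.7 (iv): removing "quasi-" -/

/-- The automorphism `Ψ^{N_{≥1}}` of Thm. 3.4 (iii) is the identity as soon as `C₁` has a Frobenius-trivial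
object, `Ψ`, `Ψ⁻¹` preserve group-like objects (Thm. 3.4 (ii)) and "when `C₁`, `C₂` are of group-like type
`Ψ` preserves Frobenius degrees" (the hypothesis of Cor. 5.7 (iv)): either some object is not group-like,
and Thm. 3.4 (iii) gives `Ψ^{N_{≥1}} = id`; or all objects are group-like on both sides, and the degrees
`n` of the endomorphisms `ζ(n)` of the Frobenius-trivial object are preserved.
[cite: MochizukiFrdI2008, Cor. 5.7 (iv) p.108] -/
theorem psiN_eq_refl (ΨN : ℕ+ ≃* ℕ+)
    (hN : ∀ ⦃A B : C₁⦄ (φ : A ⟶ B), degFr F₂ (Ψ.functor.map φ) = ΨN (degFr F₁ φ))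
    (hrefl : (∃ A : C₁, ¬ IsGroupLikeObj F₁ A) → (∃ B : C₂, ¬ IsGroupLikeObj F₂ B) →
      ΨN = MulEquiv.refl ℕ+)
    (hgl : ∀ ⦃A : C₁⦄, IsGroupLikeObj F₁ A → IsGroupLikeObj F₂ (Ψ.functor.obj A))
    (hgl' : ∀ ⦃B : C₂⦄, IsGroupLikeObj F₂ B → IsGroupLikeObj F₁ (Ψ.inverse.obj B))
    (hdeg : IsOfType (IsGroupLikeObj F₁) → IsOfType (IsGroupLikeObj F₂) →
      ∀ ⦃A B : C₁⦄ (f : A ⟶ B), degFr F₂ (Ψ.functor.map f) = degFr F₁ f)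
    {A : C₁} (hA : IsFrobeniusTrivial F₁ A) : ΨN = MulEquiv.refl ℕ+ := by
  by_cases h₁ : ∃ A : C₁, ¬ IsGroupLikeObj F₁ A
  · obtain ⟨A₀, hA₀⟩ := h₁
    refine hrefl ⟨A₀, hA₀⟩ ⟨Ψ.functor.obj A₀, fun hB => hA₀ ?_⟩
    exact IsGroupLikeObj.of_iso F₁ (Ψ.unitIso.app A₀).symm (hgl' hB)
  · push Not at h₁
    have h₂ : ∀ B : C₂, IsGroupLikeObj F₂ B := fun B =>
      IsGroupLikeObj.of_iso F₂ (Ψ.counitIso.app B) (hgl (h₁ _))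
    obtain ⟨ζ, hζ⟩ := hA
    apply MulEquiv.ext
    intro n
    have h3 := hN (ζ n)
    rw [hdeg h₁ h₂, (hζ n).1] at h3
    exact h3.symm

/-- **Corollary 5.7 (iv)** as typed (SCHEMA in `B₁`, `B₂`), DISCHARGED modulo [FrdI] Thm. 3.4 (ii) (for `Ψ`
and for `Ψ⁻¹`: preservation of group-like objects), Thm. 3.4 (iii) and Cor. 4.11 (ii): if, in the
group-like case, `Ψ` and `Ψ⁻¹` preserve Frobenius degrees, then `Ψ^{N_{≥1}} = id` on every Frobenioid with
a Frobenius-trivial object (`psiN_eq_refl`), so the "quasi-" of (i) and (iii) disappears: base-Frobenius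
pairs go to base-Frobenius pairs with `Ψ(F₁(n)_A) = F₂(n)_{Ψ A}`, and base-Frobenius pairs of
Frobenius-trivial objects likewise. [cite: MochizukiFrdI2008, Cor. 5.7 (iv) p.108] -/
theorem cor57iv_of (B₁ : (PreFrobenioidData.ofFunctor Φ₁ F₁).BiratData)
    (B₂ : (PreFrobenioidData.ofFunctor Φ₂ F₂).BiratData)
    (h34ii : (PreFrobenioidData.ofFunctor Φ₁ F₁).Thm34ii (PreFrobenioidData.ofFunctor Φ₂ F₂) Ψ)
    (h34ii' : (PreFrobenioidData.ofFunctor Φ₂ F₂).Thm34ii (PreFrobenioidData.ofFunctor Φ₁ F₁) Ψ.symm)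
    (h34 : (PreFrobenioidData.ofFunctor Φ₁ F₁).Thm34iii (PreFrobenioidData.ofFunctor Φ₂ F₂) Ψ)
    (h411 : (PreFrobenioidData.ofFunctor Φ₁ F₁).Cor411ii (PreFrobenioidData.ofFunctor Φ₂ F₂) Ψ) :
    Cor57iv F₁ F₂ Ψ B₁ B₂ := by
  intro hyp hdeg
  have hB : (PreFrobenioidData.ofFunctor Φ₁ F₁).HypB (PreFrobenioidData.ofFunctor Φ₂ F₂) Ψ := fun g₁ g₂ =>
    ⟨fun _ _ φ hφ => hyp.baseIso_functor (fun A => g₁.obj A) (fun A => g₂.obj A) φ hφ,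
      fun _ _ φ hφ => hyp.baseIso_inverse (fun A => g₁.obj A) (fun A => g₂.obj A) φ hφ⟩
  obtain ⟨⟨hft, -, -, -, hpb, -, -⟩, ΨN, hN, hrefl⟩ := h34 hyp.standard₁ hyp.standard₂ hB
  have hN' : ∀ ⦃A B : C₁⦄ (φ : A ⟶ B), degFr F₂ (Ψ.functor.map φ) = ΨN (degFr F₁ φ) := hN
  obtain ⟨ΨBase, ⟨hEq, ⟨η⟩, -⟩, -⟩ :=
    h411 { divSlim := ⟨hyp.divSlim₁, hyp.divSlim₂⟩, standard := ⟨hyp.standard₁, hyp.standard₂⟩, hypB := hB }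
  haveI := hEq
  -- Thm. 3.4 (ii) for `Ψ` and `Ψ⁻¹` (quasi-isotropic and FSMFF from "standard type" (a), (d))
  obtain ⟨-, -, hgl⟩ := h34ii hyp.standard₁.quasiIsotropic hyp.standard₂.quasiIsotropic
    hyp.standard₁.fsmff hyp.standard₂.fsmff
  obtain ⟨-, -, hgl'⟩ := h34ii' hyp.standard₂.quasiIsotropic hyp.standard₁.quasiIsotropic
    hyp.standard₂.fsmff hyp.standard₁.fsmff
  have hN1 : ∀ {A : C₁}, IsFrobeniusTrivial F₁ A → ΨN = MulEquiv.refl ℕ+ := fun hA =>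
    psiN_eq_refl F₁ F₂ Ψ ΨN hN' hrefl (fun A h => hgl h) (fun B h => hgl' h)
      (fun g₁ g₂ => (hdeg g₁ g₂).1) hA
  refine ⟨fun P₁ Fr₁ hPF => ?_, fun _ _ _ _ _ _ A₁ σ₁ φ₁ hA₁ hb => ?_⟩
  · obtain ⟨P₂, Fr₂, h, hPF₂, hc⟩ := cor57i_pairs_core F₁ F₂ Ψ ΨBase η hpb hft ΨN hN' hPF
    refine ⟨P₂, Fr₂, h, hPF₂, fun n A hA => ?_⟩
    have hΨN := hN1 (hPF.isBaseSection.isFrobeniusTrivial A hA)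
    subst hΨN
    exact hc n A hA
  · obtain ⟨P, Fr, hPF, hR⟩ := hb
    obtain ⟨P₂, Fr₂, hmaps, hPF₂, hc⟩ := cor57i_pairs_core F₁ F₂ Ψ ΨBase η hpb hft ΨN hN' hPF
    have hΨN := hN1 hA₁
    subst hΨN
    have mem₂ : P₂.obj (Ψ.functor.obj A₁) := hmaps.1 A₁ hR.mem
    obtain ⟨σ₂, hb₂, hm₂, hα, hβ⟩ :=
      exists_sigma_transport F₁ F₂ Ψ ΨBase η hmaps σ₁ hR.base_σ hR.σ_mem
    let φ₂ : ℕ+ →* End (Ψ.functor.obj A₁) :=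
      { toFun := fun n => (Fr₂ n).app ⟨Ψ.functor.obj A₁, mem₂⟩
        map_one' := by
          show (Fr₂ 1).app ⟨Ψ.functor.obj A₁, mem₂⟩ = 𝟙 (Ψ.functor.obj A₁)
          exact (congrArg (fun t : End P₂.ι => t.app ⟨Ψ.functor.obj A₁, mem₂⟩) (map_one Fr₂)).trans rfl
        map_mul' := fun m n => by
          show (Fr₂ (m * n)).app ⟨Ψ.functor.obj A₁, mem₂⟩ =
            (Fr₂ n).app ⟨Ψ.functor.obj A₁, mem₂⟩ ≫ (Fr₂ m).app ⟨Ψ.functor.obj A₁, mem₂⟩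
          exact (congrArg (fun t : End P₂.ι => t.app ⟨Ψ.functor.obj A₁, mem₂⟩) (map_mul Fr₂ m n)).trans
            rfl }
    refine ⟨σ₂, φ₂, ⟨P₂, Fr₂, hPF₂, ⟨mem₂, hb₂, hm₂, fun n => rfl⟩⟩, hα, hβ, fun n => ?_⟩
    rw [hR.φ_eq n]
    exact hc n A₁ hR.mem

end PairsOfObjects

/-! ### Corollary 5.7 from the NAMED FACTS of §3–§4

The results above are stated modulo the typed conclusion predicates of [FrdI] Thm. 3.4 (ii), (iii) and
Cor. 4.11 (ii) for the given equivalence `Ψ`.  Here they are restated conditional only on the cell's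
closed named facts `FrdI.Thm34ii`, `FrdI.Thm34iii` (file `CategoryTheoreticityFacts`) and
`FrdI.Cor411ii` (file `DivisorMonoidCategoryTheoreticityFacts`): the moment those facts are proved
(`*_holds`), Cor. 5.7 (i) [sections, pairs, pre-model clause], (ii), (iii), (iv) are unconditional. -/

section FromNamedFacts

variable {D₁ : Type u} [Category.{v} D₁] {Φ₁ : D₁ᵒᵖ ⥤ CommMonCat.{w}}
  {C₁ : Type u'} [Category.{v'} C₁] (F₁ : C₁ ⥤ ElemFrobenioid Φ₁)
  {D₂ : Type u} [Category.{v} D₂] {Φ₂ : D₂ᵒᵖ ⥤ CommMonCat.{w}}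
  {C₂ : Type u'} [Category.{v'} C₂] (F₂ : C₂ ⥤ ElemFrobenioid Φ₂)
  (Ψ : C₁ ≌ C₂)

/-- **Corollary 5.7 (ii)** (`C₁` of unit-profinite type iff `C₂` is), conditional only on the named fact
[FrdI] Cor. 4.11 (ii). [cite: MochizukiFrdI2008, Cor. 5.7 (ii) p.108] -/
theorem cor57ii_of_facts (h411 : FrdI.Cor411ii.{w, v, v', u, u'}) : Cor57ii F₁ F₂ Ψ := fun hyp =>
  cor57ii_of_cor411ii F₁ F₂ Ψ
    (h411 F₁ F₂ hyp.isFrobenioid₁ hyp.isFrobenioid₂ hyp.perfFactorial₁ hyp.perfFactorial₂ Ψ) hyp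

/-- **Corollary 5.7 (i)**, base sections (`Ψ` maps base sections to base sections), conditional only on
the named facts [FrdI] Thm. 3.4 (iii) and Cor. 4.11 (ii). [cite: MochizukiFrdI2008, Cor. 5.7 (i) p.107] -/
theorem cor57i_sections_of_facts (h34 : FrdI.Thm34iii.{w, v, v', u, u'})
    (h411 : FrdI.Cor411ii.{w, v, v', u, u'}) : Cor57i_sections F₁ F₂ Ψ := fun hyp =>
  cor57i_sections_of F₁ F₂ Ψ (h34 F₁ F₂ hyp.isFrobenioid₁ hyp.isFrobenioid₂ Ψ)
    (h411 F₁ F₂ hyp.isFrobenioid₁ hyp.isFrobenioid₂ hyp.perfFactorial₁ hyp.perfFactorial₂ Ψ) hyp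

/-- **Corollary 5.7 (i)**, base-Frobenius pairs (`Ψ` maps base-Frobenius pairs to base-Frobenius
pairs, Frobenius indices transported along `Ψ^ℕ` of Thm. 3.4 (iii)), conditional only on the named
facts [FrdI] Thm. 3.4 (iii) and Cor. 4.11 (ii). [cite: MochizukiFrdI2008, Cor. 5.7 (i) p.107] -/
theorem cor57i_pairs_of_facts (h34 : FrdI.Thm34iii.{w, v, v', u, u'})
    (h411 : FrdI.Cor411ii.{w, v, v', u, u'}) : Cor57i_pairs F₁ F₂ Ψ := fun hyp =>
  cor57i_pairs_of F₁ F₂ Ψ (h34 F₁ F₂ hyp.isFrobenioid₁ hyp.isFrobenioid₂ Ψ)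
    (h411 F₁ F₂ hyp.isFrobenioid₁ hyp.isFrobenioid₂ hyp.perfFactorial₁ hyp.perfFactorial₂ Ψ) hyp

/-- **Corollary 5.7 (i)**, pre-model clause (`C₁` of pre-model type iff `C₂` is — the first conjunct of
the typed `Cor57i_model`; its second conjunct is a schema in free birationalization data), conditional
only on the named facts [FrdI] Thm. 3.4 (iii) and Cor. 4.11 (ii), applied to `Ψ` and to `Ψ⁻¹`.
[cite: MochizukiFrdI2008, Cor. 5.7 (i) p.107] -/
theorem isOfPreModelType_iff_of_facts (h34 : FrdI.Thm34iii.{w, v, v', u, u'})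
    (h411 : FrdI.Cor411ii.{w, v, v', u, u'}) (hyp : Cor57Hypotheses F₁ F₂ Ψ) :
    IsOfPreModelType F₁ ↔ IsOfPreModelType F₂ :=
  isOfPreModelType_iff_of F₁ F₂ Ψ (h34 F₁ F₂ hyp.isFrobenioid₁ hyp.isFrobenioid₂ Ψ)
    (h411 F₁ F₂ hyp.isFrobenioid₁ hyp.isFrobenioid₂ hyp.perfFactorial₁ hyp.perfFactorial₂ Ψ)
    (h34 F₂ F₁ hyp.isFrobenioid₂ hyp.isFrobenioid₁ Ψ.symm)
    (h411 F₂ F₁ hyp.isFrobenioid₂ hyp.isFrobenioid₁ hyp.perfFactorial₂ hyp.perfFactorial₁ Ψ.symm) hyp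

/-- **Corollary 5.7 (iii)** as typed, conditional only on the named facts [FrdI] Thm. 3.4 (iii) and
Cor. 4.11 (ii). [cite: MochizukiFrdI2008, Cor. 5.7 (iii) p.108] -/
theorem cor57iii_of_facts (B₁ : (PreFrobenioidData.ofFunctor Φ₁ F₁).BiratData)
    (B₂ : (PreFrobenioidData.ofFunctor Φ₂ F₂).BiratData) (h34 : FrdI.Thm34iii.{w, v, v', u, u'})
    (h411 : FrdI.Cor411ii.{w, v, v', u, u'}) : Cor57iii F₁ F₂ Ψ B₁ B₂ := fun hyp =>
  cor57iii_of F₁ F₂ Ψ B₁ B₂ (h34 F₁ F₂ hyp.isFrobenioid₁ hyp.isFrobenioid₂ Ψ)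
    (h411 F₁ F₂ hyp.isFrobenioid₁ hyp.isFrobenioid₂ hyp.perfFactorial₁ hyp.perfFactorial₂ Ψ) hyp

/-- **Corollary 5.7 (iv)** as typed, conditional only on the named facts [FrdI] Thm. 3.4 (ii) (applied
to `Ψ` and `Ψ⁻¹`), Thm. 3.4 (iii) and Cor. 4.11 (ii). [cite: MochizukiFrdI2008, Cor. 5.7 (iv) p.108] -/
theorem cor57iv_of_facts (B₁ : (PreFrobenioidData.ofFunctor Φ₁ F₁).BiratData)
    (B₂ : (PreFrobenioidData.ofFunctor Φ₂ F₂).BiratData) (h34ii : FrdI.Thm34ii.{w, v, v', u, u'})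
    (h34 : FrdI.Thm34iii.{w, v, v', u, u'}) (h411 : FrdI.Cor411ii.{w, v, v', u, u'}) :
    Cor57iv F₁ F₂ Ψ B₁ B₂ := fun hyp =>
  cor57iv_of F₁ F₂ Ψ B₁ B₂ (h34ii F₁ F₂ hyp.isFrobenioid₁ hyp.isFrobenioid₂ Ψ)
    (h34ii F₂ F₁ hyp.isFrobenioid₂ hyp.isFrobenioid₁ Ψ.symm)
    (h34 F₁ F₂ hyp.isFrobenioid₁ hyp.isFrobenioid₂ Ψ)
    (h411 F₁ F₂ hyp.isFrobenioid₁ hyp.isFrobenioid₂ hyp.perfFactorial₁ hyp.perfFactorial₂ Ψ) hyp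

end FromNamedFacts

end PreFrobenioid

end Literature.AlgebraicGeometry.Frobenioids
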